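import Literature.NumberTheory.PAdicHodge.FontaineDpst
import Literature.NumberTheory.GaloisRepresentations.CharacterPeriodsOrbit
import HarnessLib

/-!
# Rank-one representations with periods in `B_dR(F)` are de Rham — for Fontaine's datum

Topic `NumberTheory/PAdicHodge`; namespace `Literature.NumberTheory.PAdicHodge`.
Specialisation of the period criteria of `CharacterPeriodsAdmissible` / `CharacterPeriodsOrbit`
(files of `GaloisRepresentations`: a character `ψ : Γ_F → Eˣ` with coefficients in a finite
`E/ℚ_p` is `𝔅`-admissible as soon as every `ℚ_p`-embedding `j : E → F̄` carries a stabiliser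
period) to the GENUINE period ring `B_dR(F) = Frac B_dR⁺(F)` of the tree (`bdRPeriodRingData hp`,
files `BdRPeriodRingData`, `AlgClosureToBdR`), which receives `F̄` `Γ_F`-equivariantly through
the section `F̄ ↪ B_dR⁺(F)` of `θ` (`algClosureToBdR`, `smul_algClosureToFracBdR`):

* `FramedRep.isDeRhamWith_bdR_of_stabilizerPeriods` — `r : Γ_F →ₜ* GL₁(ℚ̄_p)` with a model `rE`
  over a finite `E ⊆ ℚ̄_p` and, for every `j : E → F̄` over `ℚ_p`, some `z_j ∈ B_dR(F) ∖ {0}` with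
  `z_j = j(ψ h) · h(z_j)` whenever `h ∘ j = j` (`ψ = rE(·)₀₀`; `j(ψ h) ∈ F̄ ⊆ B_dR`), is de Rham
  for `(‹ℚ_p → F›, B_dR(F))`;
* `FramedRep.isDeRhamWith_bdR_of_characterPeriods` — the same from a compatible family
  `y_{σ∘j} = (σ∘j)(ψ σ) · σ(y_j)`;
* `PstWeilDeligneData.isDeRhamFramed_of_stabilizerPeriods_of_bdR` — the same conclusion
  `𝔇.IsDeRhamFramed r` for every `p`-adic Hodge datum `𝔇` with `𝔇.𝔅 = bdRPeriodRingData hp`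
  (and `𝔇.algebra` the ambient structure);
* `fontainePst_isDeRhamFramed_of_stabilizerPeriods` — **for THE datum `fontainePst F p hp`**
  (unconditionally `𝔅 = B_dR(F)`, `fontainePst_𝔅_eq_bdRPeriodRingData`, with the canonical
  `ℚ_p`-structure `LocalField.padicAlgebra F p hp`, `fontainePst_algebra_eq_padicAlgebra`).

This is the form in which the de Rham-ness of (locally) algebraic characters — Lubin–Tate
characters `τ ∘ χ_π` and their products — is fed to the tree: it remains to exhibit, for each
embedding, one non-zero period in `B_dR(F)` (Serre 1968, Ch. III App. A; Conrad 2011, App. B,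
Prop. B.4; Fontaine 1994, Exp. III §1.5).  No definitions, no named facts.

## References

* [FontaineAsterisque223III] J.-M. Fontaine, Astérisque 223 (1994), Exp. II §1.5 (`F̄ ⊆ B_dR⁺`),
  Exp. III §1.5 (Prop. 1.5.2) and §3.
* [SerreAbelianLadic1968] J.-P. Serre, *Abelian ℓ-adic representations and elliptic curves* (1968),
  Ch. III, App. A.
* [Conrad2011LiftingGlobal] B. Conrad, *Lifting global representations with local properties*
  (2011), App. B, Prop. B.4.
-/

noncomputable section

open Field ValuativeRel
open scoped MatrixGroups

namespace Literature.NumberTheory.PAdicHodge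

open Literature.NumberTheory.GaloisRepresentations
open Literature.NumberTheory.GaloisRepresentations.IsNonarchimedeanLocalField
open Literature.NumberTheory.Automorphic

section Ambient

variable {F : Type} [Field F] [ValuativeRel F] [TopologicalSpace F] [IsNonarchimedeanLocalField F]
  [CharZero F] {p : ℕ} [Fact p.Prime] [Fact (¬ IsUnit (p : integerC F))]
  [IsAdicComplete (Ideal.span {(p : integerC F)}) (integerC F)] [Algebra ℚ_[p] F]
  (hp : valuation F p < 1)

-- Mathlib's own global value of `maxSynthPendingDepth` (as in `isAdmissible_bdR_of_unramified`).
set_option maxSynthPendingDepth 3 in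
/-- **Rank one with stabiliser periods in `B_dR(F)` ⇒ de Rham.**  Let `r : Γ_F →ₜ* GL₁(ℚ̄_p)` have
a model `rE` over a finite `E ⊆ ℚ̄_p`, `ψ(σ) = rE(σ)₀₀`, and suppose that for every `ℚ_p`-embedding
`j : E → F̄` there is `z_j ∈ B_dR(F) ∖ {0}` with `z_j = j(ψ h) · h(z_j)` for all `h ∈ Γ_F` with
`h ∘ j = j` (`j(ψ h) ∈ F̄` mapped to `B_dR` through `F̄ ↪ B_dR⁺ ⊆ B_dR`).  Then `r` is de Rham for
`(‹ℚ_p → F›, bdRPeriodRingData hp)` (`FramedRep.isDeRhamWith_of_stabilizerPeriods` for the genuine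
ring, which receives `F̄` equivariantly: `smul_algClosureToFracBdR`, `algClosureToFracBdR_algebraMap`).
[cite: FontaineAsterisque223III, Exp. III §1.5 and §3] [cite: Conrad2011LiftingGlobal, App. B, Prop. B.4] -/
theorem _root_.Literature.NumberTheory.GaloisRepresentations.FramedRep.isDeRhamWith_bdR_of_stabilizerPeriods
    (r : FramedRep (absoluteGaloisGroup F) (PadicAlgCl p) 1)
    {E : IntermediateField ℚ_[p] (PadicAlgCl p)} [FiniteDimensional ℚ_[p] E]
    {rE : FramedRep (absoluteGaloisGroup F) E 1} (hmodel : HasQlModel r E rE)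
    (z : (E →ₐ[ℚ_[p]] AlgebraicClosure F) → FracBdR F p) (hz0 : ∀ j, z j ≠ 0)
    (hz : ∀ (j : E →ₐ[ℚ_[p]] AlgebraicClosure F) (h : absoluteGaloisGroup F),
      absGalEmbComp h j = j →
        z j = ((algebraMap (BDeRhamPlus (integerC F) p) (FracBdR F p)).comp
            (algClosureToBdR hp (surjective_fontaineTheta_integerC hp)))
              (j ((((rE h : GL (Fin 1) E) : Matrix (Fin 1) (Fin 1) E) 0 0))) * h • z j) :
    r.IsDeRhamWith ‹Algebra ℚ_[p] F› (bdRPeriodRingData (F := F) (p := p) hp) :=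
  r.isDeRhamWith_of_stabilizerPeriods ‹Algebra ℚ_[p] F› (bdRPeriodRingData hp)
    ((algebraMap (BDeRhamPlus (integerC F) p) (FracBdR F p)).comp
      (algClosureToBdR hp (surjective_fontaineTheta_integerC hp)))
    (fun σ x => smul_algClosureToFracBdR hp σ x) (fun a => algClosureToFracBdR_algebraMap hp a)
    hmodel z hz0 hz

-- Mathlib's own global value of `maxSynthPendingDepth` (as in `isAdmissible_bdR_of_unramified`).
set_option maxSynthPendingDepth 3 in
/-- **Rank one with a compatible family of periods in `B_dR(F)` ⇒ de Rham**:
`y_{σ∘j} = (σ∘j)(ψ σ) · σ(y_j)` for all `σ ∈ Γ_F` and all `j : E → F̄`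
(`FramedRep.isDeRhamWith_of_characterPeriods` for the genuine ring).
[cite: FontaineAsterisque223III, Exp. III §1.5 and §3] [cite: Conrad2011LiftingGlobal, App. B, Prop. B.4] -/
theorem _root_.Literature.NumberTheory.GaloisRepresentations.FramedRep.isDeRhamWith_bdR_of_characterPeriods
    (r : FramedRep (absoluteGaloisGroup F) (PadicAlgCl p) 1)
    {E : IntermediateField ℚ_[p] (PadicAlgCl p)} [FiniteDimensional ℚ_[p] E]
    {rE : FramedRep (absoluteGaloisGroup F) E 1} (hmodel : HasQlModel r E rE)
    (y : (E →ₐ[ℚ_[p]] AlgebraicClosure F) → FracBdR F p) (hy0 : ∀ j, y j ≠ 0)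
    (hy : ∀ (σ : absoluteGaloisGroup F) (j : E →ₐ[ℚ_[p]] AlgebraicClosure F),
      y (absGalEmbComp σ j) =
        ((algebraMap (BDeRhamPlus (integerC F) p) (FracBdR F p)).comp
            (algClosureToBdR hp (surjective_fontaineTheta_integerC hp)))
          (absGalEmbComp σ j ((((rE σ : GL (Fin 1) E) : Matrix (Fin 1) (Fin 1) E) 0 0))) * σ • y j) :
    r.IsDeRhamWith ‹Algebra ℚ_[p] F› (bdRPeriodRingData (F := F) (p := p) hp) :=
  r.isDeRhamWith_of_characterPeriods ‹Algebra ℚ_[p] F› (bdRPeriodRingData hp)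
    ((algebraMap (BDeRhamPlus (integerC F) p) (FracBdR F p)).comp
      (algClosureToBdR hp (surjective_fontaineTheta_integerC hp)))
    (fun σ x => smul_algClosureToFracBdR hp σ x) (fun a => algClosureToFracBdR_algebraMap hp a)
    hmodel y hy0 hy

/-- **The same for every `p`-adic Hodge datum whose period ring is `B_dR(F)`** (and whose
`ℚ_p`-structure is the ambient one): `𝔇.IsDeRhamFramed r` from stabiliser periods in `B_dR(F)`.
[cite: FontaineAsterisque223III, Exp. III §1.5 and §3] [cite: Conrad2011LiftingGlobal, App. B, Prop. B.4] -/
theorem _root_.Literature.NumberTheory.GaloisRepresentations.PstWeilDeligneData.isDeRhamFramed_of_stabilizerPeriods_of_bdR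
    (𝔇 : PstWeilDeligneData F p) (halg : 𝔇.algebra = ‹Algebra ℚ_[p] F›)
    (h𝔅 : 𝔇.𝔅 = (letI := 𝔇.algebra; bdRPeriodRingData (F := F) (p := p) hp))
    (r : FramedRep (absoluteGaloisGroup F) (PadicAlgCl p) 1)
    {E : IntermediateField ℚ_[p] (PadicAlgCl p)} [FiniteDimensional ℚ_[p] E]
    {rE : FramedRep (absoluteGaloisGroup F) E 1} (hmodel : HasQlModel r E rE)
    (z : (E →ₐ[ℚ_[p]] AlgebraicClosure F) → FracBdR F p) (hz0 : ∀ j, z j ≠ 0)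
    (hz : ∀ (j : E →ₐ[ℚ_[p]] AlgebraicClosure F) (h : absoluteGaloisGroup F),
      absGalEmbComp h j = j →
        z j = ((algebraMap (BDeRhamPlus (integerC F) p) (FracBdR F p)).comp
            (algClosureToBdR hp (surjective_fontaineTheta_integerC hp)))
              (j ((((rE h : GL (Fin 1) E) : Matrix (Fin 1) (Fin 1) E) 0 0))) * h • z j) :
    𝔇.IsDeRhamFramed r := by
  subst halg
  letI : Algebra ℚ_[p] F := 𝔇.algebra
  show r.IsDeRhamWith 𝔇.algebra 𝔇.𝔅
  rw [h𝔅]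
  exact r.isDeRhamWith_bdR_of_stabilizerPeriods hp hmodel z hz0 hz

end Ambient

section Canonical

variable {F : Type} [Field F] [ValuativeRel F] [TopologicalSpace F] [IsNonarchimedeanLocalField F]
  [CharZero F] {p : ℕ} [Fact p.Prime] (hp : valuation F p < 1)

/-- **Rank one with stabiliser periods in `B_dR(F)` ⇒ de Rham for THE datum `fontainePst F p hp`**
— unconditionally (`fontainePst_𝔅_eq_bdRPeriodRingData`, `fontainePst_algebra_eq_padicAlgebra`),
all `ℚ_p`-structures being the canonical `LocalField.padicAlgebra F p hp`: for
`r : Γ_F →ₜ* GL₁(ℚ̄_p)` with a model `rE` over a finite `E ⊆ ℚ̄_p` and, for every `ℚ_p`-embedding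
`j : E → F̄`, some `z_j ∈ B_dR(F) ∖ {0}` with `z_j = j(rE(h)₀₀) · h(z_j)` whenever `h ∘ j = j`,
`(fontainePst F p hp).IsDeRhamFramed r`.  (The instance arguments of `bdRPeriodRingData` are the
accepted `not_isUnit_natCast_integerC`, `isAdicComplete_integerC_natCast`.)
[cite: FontaineAsterisque223III, Exp. III §1.5 and §3] [cite: Conrad2011LiftingGlobal, App. B, Prop. B.4]
[cite: SerreAbelianLadic1968, Ch. III App. A] -/
theorem fontainePst_isDeRhamFramed_of_stabilizerPeriods :
    letI := LocalField.padicAlgebra F p hp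
    haveI : Fact (¬ IsUnit ((p : ℕ) : integerC F)) := ⟨not_isUnit_natCast_integerC hp⟩
    haveI : IsAdicComplete (Ideal.span {((p : ℕ) : integerC F)}) (integerC F) :=
      isAdicComplete_integerC_natCast hp
    ∀ (r : FramedRep (absoluteGaloisGroup F) (PadicAlgCl p) 1)
      {E : IntermediateField ℚ_[p] (PadicAlgCl p)} [FiniteDimensional ℚ_[p] E]
      {rE : FramedRep (absoluteGaloisGroup F) E 1} (_ : HasQlModel r E rE)
      (z : (E →ₐ[ℚ_[p]] AlgebraicClosure F) → FracBdR F p) (_ : ∀ j, z j ≠ 0)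
      (_ : ∀ (j : E →ₐ[ℚ_[p]] AlgebraicClosure F) (h : absoluteGaloisGroup F),
        absGalEmbComp h j = j →
          z j = ((algebraMap (BDeRhamPlus (integerC F) p) (FracBdR F p)).comp
              (algClosureToBdR hp (surjective_fontaineTheta_integerC hp)))
                (j ((((rE h : GL (Fin 1) E) : Matrix (Fin 1) (Fin 1) E) 0 0))) * h • z j),
      (fontainePst F p hp).IsDeRhamFramed r := by
  letI := LocalField.padicAlgebra F p hp
  haveI : Fact (¬ IsUnit ((p : ℕ) : integerC F)) := ⟨not_isUnit_natCast_integerC hp⟩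
  haveI : IsAdicComplete (Ideal.span {((p : ℕ) : integerC F)}) (integerC F) :=
    isAdicComplete_integerC_natCast hp
  intro r E _ rE hmodel z hz0 hz
  exact PstWeilDeligneData.isDeRhamFramed_of_stabilizerPeriods_of_bdR hp (fontainePst F p hp)
    (fontainePst_algebra_eq_padicAlgebra hp) (fontainePst_𝔅_eq_bdRPeriodRingData hp) r hmodel z hz0 hz

end Canonical

end Literature.NumberTheory.PAdicHodge

end
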